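import Literature.MathematicalPhysics.QuantumFieldTheory.Balaban1983to89.B9Eq358TaxiLettersY
import Literature.MathematicalPhysics.QuantumFieldTheory.Balaban1983to89.B9Eq340TaxiTelescope
import Literature.MathematicalPhysics.QuantumFieldTheory.Balaban1983to89.Node00.OpsYHolderFar

/-!
# `Balaban1983to89.B9Eq340CovariantLipschitzY` — the HÖLDER-FROM-GRADIENT bound for def-Y's SITE quotient (3.40) (`parSymY`, torus distance `η|z′−z|_T`) at a REAL
# (unitary-like) background, on n06-w6's covariant telescoping `B9Eq340TaxiTelescope`: `‖R(parSymY U z z′)Ψ(z′) − Ψ(z)‖∕(η|z′−z|_T)^α ≤ (d+1)·L^k·G·(η|z′−z|_T)^{1−α}`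

T. Bałaban, *Propagators for lattice gauge theories in a background field*, Commun. Math. Phys. **99** (1985) 389–434
[`Balaban1985BackgroundPropagators`, "B9"]; [4] = T. Bałaban, *Propagators and renormalization transformations for lattice gauge
theories. II*, Commun. Math. Phys. **96** (1984) 223–250 [`Balaban1984PropagatorsII`].

statement-level skeleton of published theorems with citation tags; proofs where landed; nothing here is a claim about the
Yang–Mills mass gap

THE PRINTED LOCI.  (3.40) p. 397 (*"R(U(Γ_{x,x′})) … where Γ_{x,x′} is a shortest contour connecting points x and x′"*), (3.3)–(3.8) pp. 391–392 (the
covariant differences), (3.42)–(3.43) pp. 397–398 (the sup members dominate the Hölder members of the undifferentiated operator: the input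
`‖Φ(G′(U)μ)‖ ≦ B_h(Lʲη)^{2−β}…` of the right transfer of Sect. B, p. 403).

WHY THIS FILE (seat dag-n06-c gen 11; the Hölder members of row 13 under LOCATED-11's repair R13-U1 — U-letters).  r06's RIGHT (3.43) transfer
(`B9SectBGpStepAtLettersV2.H1Frame₂.h1_transfer`, hypothesis block :710–713) asks for the Hölder probe of the UNDIFFERENTIATED `G′(U)μ` with the weight
`(Lʲη)^{2−β}`, which no displayed block of Theorem 3.1 carries; print derives it from the sup members (3.42)₀,₁,₂ by the elementary fact that a covariant
Hölder quotient is at most the contour length times the sup of the covariant differences along the contour — AT A REAL `U` (the transport `R(U(Γ))` contracts).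
The telescoping itself is dag-n06-w6's `B9Eq340TaxiTelescope` (`norm_sub_R_parTaxiV_le`, bond sector `parBY`, `supDist` weights) — used BY NAME.  THIS FILE adds what
the SITE reader `hqS` (def-Y's `parSY`∕`parSymY`, print's torus distance `pdist`) needs: §1 the REVERSED orientation (`parSymY`'s second branch transports with an inverse);
§2 the `parSY`∕`parSymY` forms on `SiteY` (box chart); §3 the rung count of the taxicab contour against `pdist` (`|Γ_{z,z′}| ≤ (d+1)·L^k·η|z′−z|_T`, `0 < η|z′−z|_T` for
`z ≠ z′`) and the quotient `‖R(parSymY U z z′)Ψ(z′) − Ψ(z)‖∕(η|z′−z|_T)^α ≤ (d+1)·L^k·G·(η|z′−z|_T)^{1−α}`.  Nothing of [B9] asserted.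
HONEST SCOPE.  Elementary; the contracting transport is the explicit unitary-like hypothesis; COUNT-NEUTRAL; N06 NOT discharged; one finite lattice programme —
nothing continuum, nothing about OS positivity or the mass gap.
-/

noncomputable section

namespace Literature.MathematicalPhysics.QuantumFieldTheory.Balaban1983to89.B9Eq340CovariantLipschitzY

open T4RelativeLadder (UnitaryLike)
open B9BackgroundsKLevelV1 (CfgV1)
open B9BackgroundsKLevelV1 (shiftsV1)
open B9Eq39Adjoint (R R_sub R_inv_R covD)
open B9Eq340StepLasso (stepRun stepEnd rungSites unitaryLike_stepRun parTaxiV_eq_stepRun taxiSteps)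
open B9Eq340TaxiTelescope (norm_R_le norm_sub_R_parTaxiV_le)
open Node00 (parTaxiV)

variable {P : Params} {𝔸 : Type} [NormedRing 𝔸]

/-! ## §1 The reversed orientation of n06-w6's telescoping bound -/

/-- ★ **THE REVERSED ORIENTATION** of `B9Eq340TaxiTelescope.norm_sub_R_parTaxiV_le`: `‖R(U(Γ_{x′,x})⁻¹)X(x′) − X(x)‖ ≤ |Γ_{x′,x}|·δ` under the rung-wise
bound along the contour from `x′` to `x` (the transporter of the whole contour is unitary-like; `[NormOneClass 𝔸]`).
[cite: Balaban1985BackgroundPropagators, (3.40) p.397, (3.3)–(3.8) pp.391–392] -/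
theorem norm_R_inv_parTaxiV_sub_le [NormOneClass 𝔸] {U : CfgV1 P 𝔸} (hU : ∀ μ x, UnitaryLike (U μ x)) (X : Site P 0 → 𝔸) (x x' : Site P 0)
    {δ : ℝ} (h : ∀ r ∈ rungSites (taxiSteps (List.finRange P.d) x' x) x', ‖covD (shiftsV1 P) U r.2.1 X r.1‖ ≤ δ) :
    ‖R (parTaxiV U x' x)⁻¹ (X x') - X x‖ ≤ (taxiSteps (List.finRange P.d) x' x).length * δ := by
  set p := parTaxiV U x' x with hp
  have hpu : UnitaryLike p := by rw [hp, parTaxiV_eq_stepRun]; exact unitaryLike_stepRun hU _ _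
  have hrew : R p⁻¹ (X x') - X x = R p⁻¹ (X x' - R p (X x)) := by rw [R_sub, R_inv_R]
  rw [hrew]
  exact (norm_R_le hpu.inv _).trans (norm_sub_R_parTaxiV_le hU X x' x h)

/-! ## §2 def-Y's site transporters `parSY` ∕ `parSymY` -/

section SiteY

open B6GlobalChartV1 (boxEquiv)
open B6KLevelCensusIndexV1 (KIdx)
open Node00 (SiteY CfgY parSY parSymY parSymY_of_le parSymY_of_not_le)

variable {d ℓ : ℕ} {hd : 1 ≤ d + 1} {hL : Odd (ℓ + 1) ∧ 1 < ℓ + 1} {b₀ b₁ : ℝ} [NormedAlgebra ℂ 𝔸] [CompleteSpace 𝔸] (i : KIdx d ℓ hd hL b₀ b₁)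

/-- the box chart round trip on sites. [cite: Balaban1984PropagatorsII, (2.1) p.224, bookkeeping] -/
theorem boxEquiv_apply_symm (z : SiteY i) : boxEquiv i.hN ((boxEquiv i.hN).symm z) = z := (boxEquiv i.hN).apply_symm_apply z

/-- ★ **`parSY`, TELESCOPED**: `‖R(parSY U z z′)Ψ(z′) − Ψ(z)‖ ≤ |Γ|·G` under a rung-wise bound on the covariant differences of `Ψ ∘ boxEquiv` along the contour
from `z` to `z′` (torus coordinates). [cite: Balaban1985BackgroundPropagators, (3.40) p.397] -/
theorem norm_R_parSY_sub_le {U : CfgY 𝔸 i} (hU : ∀ μ x, UnitaryLike (U μ x)) (Ψ : SiteY i → 𝔸) (z z' : SiteY i) {G : ℝ}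
    (hG : ∀ r ∈ rungSites (taxiSteps (List.finRange (d + 1)) ((boxEquiv i.hN).symm z) ((boxEquiv i.hN).symm z')) ((boxEquiv i.hN).symm z),
      ‖covD (shiftsV1 _) U r.2.1 (fun x => Ψ (boxEquiv i.hN x)) r.1‖ ≤ G) :
    ‖R (parSY i U z z') (Ψ z') - Ψ z‖ ≤ (taxiSteps (List.finRange (d + 1)) ((boxEquiv i.hN).symm z) ((boxEquiv i.hN).symm z')).length * G := by
  have h := norm_sub_R_parTaxiV_le hU (fun x => Ψ (boxEquiv i.hN x)) ((boxEquiv i.hN).symm z) ((boxEquiv i.hN).symm z') hG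
  simp only [boxEquiv_apply_symm] at h
  rw [norm_sub_rev]
  exact h

/-- ★ **`parSY` REVERSED**: `‖R((parSY U z′ z)⁻¹)Ψ(z′) − Ψ(z)‖ ≤ |Γ′|·G` (contour from `z′` to `z`). [cite: Balaban1985BackgroundPropagators, (3.40) p.397] -/
theorem norm_R_inv_parSY_sub_le [NormOneClass 𝔸] {U : CfgY 𝔸 i} (hU : ∀ μ x, UnitaryLike (U μ x)) (Ψ : SiteY i → 𝔸) (z z' : SiteY i) {G : ℝ}
    (hG : ∀ r ∈ rungSites (taxiSteps (List.finRange (d + 1)) ((boxEquiv i.hN).symm z') ((boxEquiv i.hN).symm z)) ((boxEquiv i.hN).symm z'),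
      ‖covD (shiftsV1 _) U r.2.1 (fun x => Ψ (boxEquiv i.hN x)) r.1‖ ≤ G) :
    ‖R (parSY i U z' z)⁻¹ (Ψ z') - Ψ z‖ ≤ (taxiSteps (List.finRange (d + 1)) ((boxEquiv i.hN).symm z') ((boxEquiv i.hN).symm z)).length * G := by
  have h := norm_R_inv_parTaxiV_sub_le hU (fun x => Ψ (boxEquiv i.hN x)) ((boxEquiv i.hN).symm z) ((boxEquiv i.hN).symm z') hG
  simp only [boxEquiv_apply_symm] at h
  exact h

/-- ★★ **`parSymY` (EITHER ORIENTATION)**: with rung-wise bounds `G` along both contours and a common length bound `n`,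
`‖R(parSymY U z z′)Ψ(z′) − Ψ(z)‖ ≤ n·G`. [cite: Balaban1985BackgroundPropagators, (3.40) p.397 («a shortest contour»)] -/
theorem norm_R_parSymY_sub_le [NormOneClass 𝔸] {U : CfgY 𝔸 i} (hU : ∀ μ x, UnitaryLike (U μ x)) (Ψ : SiteY i → 𝔸) (z z' : SiteY i) {G : ℝ}
    (hG0 : 0 ≤ G) {n : ℕ}
    (hG : ∀ r ∈ rungSites (taxiSteps (List.finRange (d + 1)) ((boxEquiv i.hN).symm z) ((boxEquiv i.hN).symm z')) ((boxEquiv i.hN).symm z),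
      ‖covD (shiftsV1 _) U r.2.1 (fun x => Ψ (boxEquiv i.hN x)) r.1‖ ≤ G)
    (hG' : ∀ r ∈ rungSites (taxiSteps (List.finRange (d + 1)) ((boxEquiv i.hN).symm z') ((boxEquiv i.hN).symm z)) ((boxEquiv i.hN).symm z'),
      ‖covD (shiftsV1 _) U r.2.1 (fun x => Ψ (boxEquiv i.hN x)) r.1‖ ≤ G)
    (hn : (taxiSteps (List.finRange (d + 1)) ((boxEquiv i.hN).symm z) ((boxEquiv i.hN).symm z')).length ≤ n)
    (hn' : (taxiSteps (List.finRange (d + 1)) ((boxEquiv i.hN).symm z') ((boxEquiv i.hN).symm z)).length ≤ n) :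
    ‖R (parSymY i U z z') (Ψ z') - Ψ z‖ ≤ n * G := by
  by_cases hle : toLex z.1 ≤ toLex z'.1
  · rw [parSymY_of_le hle]
    exact (norm_R_parSY_sub_le i hU Ψ z z' hG).trans (mul_le_mul_of_nonneg_right (by exact_mod_cast hn) hG0)
  · rw [parSymY_of_not_le hle]
    exact (norm_R_inv_parSY_sub_le i hU Ψ z z' hG').trans (mul_le_mul_of_nonneg_right (by exact_mod_cast hn') hG0)

end SiteY

/-! ## §3 The rung count of the taxicab contour against print's torus distance, and the Hölder-from-gradient bound -/

section Count

open B4TorusKernel.MultiPeriod (circAbs torusSupNorm torusSupNorm_nonneg)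
open B6GlobalChartV1 (boxEquiv PV)
open B6KLevelCensusIndexV1 (KIdx)
open B6Prop22KLevelTorusCensus.KTIdx (circAbs_le_torusSupNorm)
open B6Prop22KLevelTorusCensusEta (nKT nKT_pos)
open B9Eq340TaxiRungs (length_taxiSteps_le)
open B9Eq358TaxiLettersY (val_boxEquiv_symm_int)
open Node00 (SiteY CfgY toKT parSymY parSymY_of_le parSymY_of_not_le)
open Node00.OpsYHolderFar (pdist denS pdist_nonneg denS_nonneg one_le_NB)

variable {d ℓ : ℕ} {hd : 1 ≤ d + 1} {hL : Odd (ℓ + 1) ∧ 1 < ℓ + 1} {b₀ b₁ : ℝ} [NormedAlgebra ℂ 𝔸] [CompleteSpace 𝔸] (i : KIdx d ℓ hd hL b₀ b₁)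

omit [NormedAlgebra ℂ 𝔸] [CompleteSpace 𝔸] in
/-- one coordinate: `dist(a − b, Nℤ) = min{(a − b) mod N, (b − a) mod N}` (cast to `ℝ`; p22 `B6BlockDecayHprimeCovV1`'s private lemma, copied).
[cite: Balaban1984PropagatorsI, p.17 l.30 (torus distance)] -/
private theorem circAbs_val_sub_cast {n : ℕ} [NeZero n] (a b : ZMod n) :
    ((circAbs n (((a.val : ℕ) : ℤ) - ((b.val : ℕ) : ℤ)) : ℤ) : ℝ) = ((min (a - b).val (b - a).val : ℕ) : ℝ) := by
  have hab : (a - b : ZMod n) = (((a.val : ℤ) - (b.val : ℤ) : ℤ) : ZMod n) := by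
    push_cast
    rw [ZMod.natCast_zmod_val, ZMod.natCast_zmod_val]
  have hr : (((a - b).val : ℕ) : ℤ) = ((a.val : ℤ) - (b.val : ℤ)) % (n : ℤ) := by
    rw [hab, ZMod.val_intCast]
  have hs : (b - a).val = if a - b = 0 then 0 else n - (a - b).val := by
    rw [← neg_sub, ZMod.neg_val]
  have key : circAbs n (((a.val : ℕ) : ℤ) - ((b.val : ℕ) : ℤ)) = ((min (a - b).val (b - a).val : ℕ) : ℤ) := by
    unfold circAbs
    rw [← hr, hs]
    split_ifs with h0
    · rw [h0, ZMod.val_zero]; simp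
    · have hlt : (a - b).val < n := ZMod.val_lt _
      have : ((n : ℤ) - (((a - b).val : ℕ) : ℤ)) = ((n - (a - b).val : ℕ) : ℤ) := by
        rw [Nat.cast_sub hlt.le]
      rw [this, ← Nat.cast_min]
  rw [key, Int.cast_natCast]

/-- ★ one coordinate of the taxicab count against print's torus distance: `min{(x′_ν − x_ν) mod N, (x_ν − x′_ν) mod N} ≤ L^k·(η|z′ − z|_T)` for the torus
coordinates `x = chart⁻¹ z`, `x′ = chart⁻¹ z′`. [cite: Balaban1985BackgroundPropagators, (3.40) p.397; Balaban1984PropagatorsII, (2.1) p.224] -/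
theorem min_val_sub_le_mul_pdist (z z' : SiteY i) (ν : Fin (d + 1)) :
    ((min (((boxEquiv i.hN).symm z') ν - ((boxEquiv i.hN).symm z) ν).val (((boxEquiv i.hN).symm z) ν - ((boxEquiv i.hN).symm z') ν).val : ℕ) : ℝ)
      ≤ ((nKT (toKT i) : ℕ) : ℝ) * pdist i z z' := by
  have hN := nKT_pos (toKT i)
  have hmul : ((nKT (toKT i) : ℕ) : ℝ) * pdist i z z' = torusSupNorm (toKT i).NB (z'.1 - z.1) := by
    unfold pdist; field_simp
  rw [hmul]
  haveI : NeZero ((toKT i).NB ν) := ⟨by have := one_le_NB i ν; omega⟩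
  have hcast : ((circAbs ((toKT i).NB ν) ((z'.1 - z.1) ν) : ℤ) : ℝ)
      = ((min (((boxEquiv i.hN).symm z') ν - ((boxEquiv i.hN).symm z) ν).val (((boxEquiv i.hN).symm z) ν - ((boxEquiv i.hN).symm z') ν).val : ℕ) : ℝ) := by
    have h := circAbs_val_sub_cast (n := (PV d ℓ i.m i.K hd hL).sitesPerDir 0) (((boxEquiv i.hN).symm z') ν) (((boxEquiv i.hN).symm z) ν)
    rw [val_boxEquiv_symm_int i z' ν, val_boxEquiv_symm_int i z ν] at h
    rw [← h, Pi.sub_apply]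
    congr 2
    exact i.hN ν
  rw [← hcast]
  exact circAbs_le_torusSupNorm _ _ ν

/-- ★ **THE RUNG COUNT**: the taxicab contour from `chart⁻¹ z` towards `chart⁻¹ z′` has at most `(d+1)·L^k·(η|z′ − z|_T)` steps.
[cite: Balaban1985BackgroundPropagators, (3.40) p.397 («a shortest contour»); Balaban1984PropagatorsII, (2.1) p.224] -/
theorem length_taxiSteps_le_mul_pdist (z z' : SiteY i) :
    ((taxiSteps (List.finRange (d + 1)) ((boxEquiv i.hN).symm z) ((boxEquiv i.hN).symm z')).length : ℝ)
      ≤ ((d : ℝ) + 1) * (((nKT (toKT i) : ℕ) : ℝ) * pdist i z z') := by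
  classical
  -- the largest coordinate count
  set K : ℕ := Finset.univ.sup fun ν : Fin (d + 1) =>
    min (((boxEquiv i.hN).symm z') ν - ((boxEquiv i.hN).symm z) ν).val (((boxEquiv i.hN).symm z) ν - ((boxEquiv i.hN).symm z') ν).val with hK
  have hKν : ∀ ν, min (((boxEquiv i.hN).symm z') ν - ((boxEquiv i.hN).symm z) ν).val (((boxEquiv i.hN).symm z) ν - ((boxEquiv i.hN).symm z') ν).val ≤ K :=
    fun ν => Finset.le_sup (f := fun ν : Fin (d + 1) =>
      min (((boxEquiv i.hN).symm z') ν - ((boxEquiv i.hN).symm z) ν).val (((boxEquiv i.hN).symm z) ν - ((boxEquiv i.hN).symm z') ν).val) (Finset.mem_univ ν)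
  have hlen := length_taxiSteps_le ((boxEquiv i.hN).symm z) ((boxEquiv i.hN).symm z') hKν (List.finRange (d + 1))
  rw [List.length_finRange] at hlen
  -- `K ≤ L^k·pdist`: `K` is attained at some coordinate
  have hKle : (K : ℝ) ≤ ((nKT (toKT i) : ℕ) : ℝ) * pdist i z z' := by
    obtain ⟨ν, -, hν⟩ := Finset.exists_mem_eq_sup (Finset.univ : Finset (Fin (d + 1))) Finset.univ_nonempty
      (fun ν : Fin (d + 1) => min (((boxEquiv i.hN).symm z') ν - ((boxEquiv i.hN).symm z) ν).val (((boxEquiv i.hN).symm z) ν - ((boxEquiv i.hN).symm z') ν).val)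
    rw [hK, hν]
    exact min_val_sub_le_mul_pdist i z z' ν
  calc ((taxiSteps (List.finRange (d + 1)) ((boxEquiv i.hN).symm z) ((boxEquiv i.hN).symm z')).length : ℝ)
      ≤ (((d + 1) * K : ℕ) : ℝ) := by exact_mod_cast hlen
    _ = ((d : ℝ) + 1) * K := by push_cast; ring
    _ ≤ ((d : ℝ) + 1) * (((nKT (toKT i) : ℕ) : ℝ) * pdist i z z') := mul_le_mul_of_nonneg_left hKle (by positivity)

/-- ★ distinct sites are at least one lattice step apart: `1 ≤ L^k·(η|z′ − z|_T)` (so `0 < η|z′ − z|_T`). [cite: Balaban1985BackgroundPropagators, (3.40) p.397, bookkeeping] -/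
theorem one_le_mul_pdist_of_ne {z z' : SiteY i} (hne : z ≠ z') : 1 ≤ ((nKT (toKT i) : ℕ) : ℝ) * pdist i z z' := by
  -- some coordinate differs
  have hx : (boxEquiv i.hN).symm z ≠ (boxEquiv i.hN).symm z' := fun h => hne ((boxEquiv i.hN).symm.injective h)
  obtain ⟨ν, hν⟩ : ∃ ν, ((boxEquiv i.hN).symm z) ν ≠ ((boxEquiv i.hN).symm z') ν := by
    by_contra h
    push Not at h
    exact hx (funext h)
  have h1 : 1 ≤ min (((boxEquiv i.hN).symm z') ν - ((boxEquiv i.hN).symm z) ν).val (((boxEquiv i.hN).symm z) ν - ((boxEquiv i.hN).symm z') ν).val := by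
    refine le_min ?_ ?_
    · exact Nat.one_le_iff_ne_zero.2 fun h => hν ((sub_eq_zero.1 ((ZMod.val_eq_zero _).1 h)).symm)
    · exact Nat.one_le_iff_ne_zero.2 fun h => hν (sub_eq_zero.1 ((ZMod.val_eq_zero _).1 h))
  have h2 := min_val_sub_le_mul_pdist i z z' ν
  exact le_trans (by exact_mod_cast h1) h2

/-- `0 < η|z′ − z|_T` for `z ≠ z′`. [cite: Balaban1985BackgroundPropagators, (3.40) p.397, bookkeeping] -/
theorem pdist_pos_of_ne {z z' : SiteY i} (hne : z ≠ z') : 0 < pdist i z z' := by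
  have h := one_le_mul_pdist_of_ne i hne
  have hN := nKT_pos (toKT i)
  by_contra hle
  have : pdist i z z' = 0 := le_antisymm (not_lt.1 hle) (pdist_nonneg i z z')
  rw [this, mul_zero] at h
  linarith

/-- ★★ **HÖLDER FROM GRADIENT (the (3.40) quotient of one pair at a real background)**: for unitary-like `U`, `z ≠ z′`, any exponent `α`, and a bound `G ≥ 0` on the
covariant differences of `Ψ` along both taxicab contours between `z` and `z′`:
`‖R(parSymY U z z′)Ψ(z′) − Ψ(z)‖ ∕ (η|z′−z|_T)^α ≤ (d+1)·L^k·G·(η|z′−z|_T)^{1−α}`. [cite: Balaban1985BackgroundPropagators, (3.40) p.397, (3.42)–(3.43) pp.397–398] -/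
theorem quot_parSymY_le_of_rungwise [NormOneClass 𝔸] {U : CfgY 𝔸 i} (hU : ∀ μ x, UnitaryLike (U μ x)) (Ψ : SiteY i → 𝔸) {z z' : SiteY i} (hne : z ≠ z')
    (α : ℝ) {G : ℝ} (hG0 : 0 ≤ G)
    (hG : ∀ r ∈ rungSites (taxiSteps (List.finRange (d + 1)) ((boxEquiv i.hN).symm z) ((boxEquiv i.hN).symm z')) ((boxEquiv i.hN).symm z),
      ‖covD (shiftsV1 _) U r.2.1 (fun x => Ψ (boxEquiv i.hN x)) r.1‖ ≤ G)
    (hG' : ∀ r ∈ rungSites (taxiSteps (List.finRange (d + 1)) ((boxEquiv i.hN).symm z') ((boxEquiv i.hN).symm z)) ((boxEquiv i.hN).symm z'),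
      ‖covD (shiftsV1 _) U r.2.1 (fun x => Ψ (boxEquiv i.hN x)) r.1‖ ≤ G) :
    ‖R (parSymY i U z z') (Ψ z') - Ψ z‖ / denS i α z z' ≤ ((d : ℝ) + 1) * ((nKT (toKT i) : ℕ) : ℝ) * G * pdist i z z' ^ (1 - α) := by
  have hp : 0 < pdist i z z' := pdist_pos_of_ne i hne
  have hden : 0 < denS i α z z' := Real.rpow_pos_of_pos hp α
  -- numerator ≤ (d+1)·L^k·pdist·G by the telescoping on the shorter of the two oriented contours
  have hnum : ‖R (parSymY i U z z') (Ψ z') - Ψ z‖ ≤ ((d : ℝ) + 1) * (((nKT (toKT i) : ℕ) : ℝ) * pdist i z z') * G := by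
    by_cases hle : toLex z.1 ≤ toLex z'.1
    · rw [parSymY_of_le hle]
      refine (norm_R_parSY_sub_le i hU Ψ z z' hG).trans ?_
      exact mul_le_mul_of_nonneg_right (length_taxiSteps_le_mul_pdist i z z') hG0
    · rw [parSymY_of_not_le hle]
      refine (norm_R_inv_parSY_sub_le i hU Ψ z z' hG').trans ?_
      refine mul_le_mul_of_nonneg_right ?_ hG0
      have h := length_taxiSteps_le_mul_pdist i z' z
      have hsymm : pdist i z' z = pdist i z z' := by
        unfold pdist
        rw [show z.1 - z'.1 = -(z'.1 - z.1) by abel, B6Geom246MultiLevelTorus.torusSupNorm_neg (one_le_NB i)]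
      rwa [hsymm] at h
  rw [div_le_iff₀ hden]
  refine hnum.trans (le_of_eq ?_)
  unfold denS
  rw [show ((d : ℝ) + 1) * ((nKT (toKT i) : ℕ) : ℝ) * G * pdist i z z' ^ (1 - α) * pdist i z z' ^ α
      = ((d : ℝ) + 1) * ((nKT (toKT i) : ℕ) : ℝ) * G * (pdist i z z' ^ (1 - α) * pdist i z z' ^ α) by ring,
    ← Real.rpow_add hp, sub_add_cancel, Real.rpow_one]
  ring

end Count

end Literature.MathematicalPhysics.QuantumFieldTheory.Balaban1983to89.B9Eq340CovariantLipschitzY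

end
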